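import Summits.ValiantsHypothesis.ValiantsHypothesis.Theses.UlrichPadded
import Literature.Computability.AlgebraicComplexity.VonZurGathenSingPermHeight
import Literature.Computability.AlgebraicComplexity.PencilFamily

/-!
# `UlrichPadded.LevelledCorankTwo` (stmt-ValiantsHypothesis-15033): the linear part of a levelled
affine determinantal representation of `per_n` (`n ≥ 3`) has identically vanishing adjugate

Support item (rank 9) of route `UlrichPadded`:

  `∀ n ≥ 3, ∀ m (A : Matrix (Fin m) (Fin m) ℂ[x_{n×n}]), IsAffineDetRepr per_n A →
     ∀ α β : Fin m → ℤ, (A₀ i j ≠ 0 → α i + β j = 0) → (L i j ≠ 0 → α i + β j = 1) → adj L = 0`,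

where `A₀ = A(0)` is the constant part and `L = (hc₁ (A i j))` the linear part of `A`.

## Proof (von zur Gathen's two theorems + a permutation-expansion pigeonhole; no rank theory)

Call `α i` the level of row `i` and `-β j` the level of column `j`.  The hypotheses say: a non-zero
entry of `A₀` joins a row and a column of the same level, a non-zero entry of `L` joins a column of
level `v - 1` to a row of level `v`.

* **Pigeonhole** (`det_eq_zero_of_rows_supported`): if a set of rows of a square matrix is
  supported in a set of strictly fewer columns, every term of the permutation expansion of the
  determinant has a zero factor; dually for columns.
* **Sink level.** `det A₀ = per_n(0) = 0`, so `w ᵥ* A₀ = 0` for some `w ≠ 0`; pick `i₀` with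
  `w i₀ ≠ 0`, put `t = α i₀` and let `w'` be `w` restricted to the rows of level `t`.  By the
  block structure still `w' ᵥ* A₀ = 0`, whence `(C ∘ w') ᵥ* A = b` with
  `b j = Σ_i C (w' i) L i j` supported on the columns of level `t - 1`, and
  `C (w' i₀) · per_n = Σ_j b j · adj A j i₀` (multiply `A · adj A = per_n · 1` by `C ∘ w'`).
* **von zur Gathen, Lemma 2.3** (`perPoly_ne_sum_linear_mul`): `per_n` (`n ≥ 3`) is not of the
  form `ℓ₁ q₁ + ℓ₂ q₂` with linear forms `ℓ_i` — homogenising the `q_i` to degree `n - 1`, the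
  proper ideal `(ℓ₁, ℓ₂, q₁, q₂)` would contain `per_n` and its partials, so a minimal prime over
  it would have height `≤ 4` (Krull) and `≥ 5` (`vonzurGathen1987_singPerm_height_holds`).
  Hence level `t - 1` has at least THREE columns.
* **von zur Gathen, Thm. 3.1** at the origin (`false_of_adjugate_eval_eq_zero`, both height facts
  discharged in the tree): `adj A₀ ≠ 0`.  The rows of level `≥ t` of `A₀` are supported in the
  columns of level `≥ t`, so by pigeonhole `#{rows of level ≥ t} ≤ #{columns of level ≥ t} + 1`.
* **Count.** The columns of level `≥ t - 1` of `L` are supported in the rows of level `≥ t`, and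
  there are at least `#{rows of level ≥ t} + 2` of them; replacing one row of `L` by a unit vector
  (the minors in `Matrix.adjugate_apply`) adds at most one supporting row, so pigeonhole kills
  every entry of `adj L`.

For `n = 2` the statement is false (`per₂ ∈ (x₁₁, x₂₁)`; the `3 × 3` ABP representation of `per₂`
is levelled with `corank L = 1`), consistent with the guard `3 ≤ n`.
## References

* [Vonzurgathen1987] J. von zur Gathen, *Permanent and determinant*, Linear Algebra Appl. 96
  (1987) 87–100, Lemma 2.3 and Thm. 3.1 (both PROVED in the tree:
  `VonZurGathenSingPermHeight.lean`).
* Paper proof: `Cruxes/NoTightInfinity/Ideas/homothety-lift-grading.md`, Lever (1)–(3); levelled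
  examples: [LandsbergRessayre2017] (equivariant normal forms), [Grenet2011], [Valiant1979].
-/

noncomputable section

namespace Summit.ValiantsHypothesis.Theorems

open MvPolynomial Matrix Literature.Computability.AlgebraicComplexity
open Literature.Computability.AlgebraicComplexity.VonZurGathen

namespace LevelledCorankTwo

/-! ### Pigeonhole on the permutation expansion -/

section Pigeonhole

variable {ι : Type*} [Fintype ι] [DecidableEq ι] {R : Type*} [CommRing R]

/-- **Pigeonhole for determinants (rows).** If the rows `Rs` of a square matrix are supported in
a set of columns `Cs` with `#Cs < #Rs`, the determinant vanishes: for every permutation `σ` some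
row `i ∈ Rs` is matched with a column `σ⁻¹ i ∉ Cs`, so the `σ`-term of the Leibniz expansion has
the zero factor `M i (σ⁻¹ i)`. [folklore] -/
theorem det_eq_zero_of_rows_supported (M : Matrix ι ι R) (Rs Cs : Finset ι)
    (hsupp : ∀ i ∈ Rs, ∀ j, j ∉ Cs → M i j = 0) (hcard : Cs.card < Rs.card) : M.det = 0 := by
  rw [Matrix.det_apply']
  refine Finset.sum_eq_zero fun σ _ => ?_
  obtain ⟨i, hi, hiC⟩ : ∃ i ∈ Rs, σ.symm i ∉ Cs := by
    by_contra h
    push Not at h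
    have hinj : Set.InjOn σ.symm (Rs : Set ι) := fun a _ b _ hab => σ.symm.injective hab
    have hle := Finset.card_le_card_of_injOn σ.symm (fun a ha => h a ha) hinj
    omega
  have hprod : ∏ k, M (σ k) k = 0 :=
    Finset.prod_eq_zero (i := σ.symm i) (Finset.mem_univ _) (by
      show M (σ (σ.symm i)) (σ.symm i) = 0
      rw [Equiv.apply_symm_apply]
      exact hsupp i hi _ hiC)
  rw [hprod, mul_zero]

/-- **Pigeonhole for determinants (columns).** If the columns `Cs` of a square matrix are
supported in a set of rows `Rs` with `#Rs < #Cs`, the determinant vanishes (transpose of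
`det_eq_zero_of_rows_supported`). [folklore] -/
theorem det_eq_zero_of_cols_supported (M : Matrix ι ι R) (Cs Rs : Finset ι)
    (hsupp : ∀ j ∈ Cs, ∀ i, i ∉ Rs → M i j = 0) (hcard : Rs.card < Cs.card) : M.det = 0 := by
  rw [← Matrix.det_transpose]
  exact det_eq_zero_of_rows_supported Mᵀ Cs Rs (fun j hj i hi => hsupp j hj i hi) hcard

end Pigeonhole

/-! ### Affine entries split as constant part plus linear part -/

/-- A polynomial of total degree `≤ 1` is its constant term plus its linear part:
`φ = C (φ(0)) + hc₁ φ`. [folklore] -/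
theorem eq_C_add_homogeneousComponent_one {σ : Type*} {R : Type*} [CommSemiring R]
    {φ : MvPolynomial σ R} (h : φ.totalDegree ≤ 1) :
    φ = C (constantCoeff φ) + homogeneousComponent 1 φ := by
  calc φ = ∑ i ∈ Finset.range (φ.totalDegree + 1), homogeneousComponent i φ :=
        (sum_homogeneousComponent φ).symm
    _ = ∑ i ∈ Finset.range 2, homogeneousComponent i φ := by
        apply Finset.sum_subset (Finset.range_subset_range.2 (by omega))
        intro i hi hi'
        apply homogeneousComponent_eq_zero
        simp only [Finset.mem_range] at hi hi'
        omega
    _ = C (constantCoeff φ) + homogeneousComponent 1 φ := by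
        rw [Finset.sum_range_succ, Finset.sum_range_one, homogeneousComponent_zero]
        rfl

/-! ### von zur Gathen's Lemma 2.3: `per_n` is in no ideal of two linear forms -/

/-- **`per_n ∉ (ℓ₁, ℓ₂)` for linear forms, `n ≥ 3`** (von zur Gathen 1987, Lemma 2.3, via
Krull's height theorem): `per_n` is not of the form `Σ_{i ∈ s} ℓ_i q_i` with `#s ≤ 2` and the `ℓ_i`
homogeneous of degree `1`.  Otherwise, replacing each `q_i` by its degree-`(n-1)` component, the
ideal `I = (ℓ_i, q_i)_i` has `≤ 4` generators without constant term (so `I ≠ ⊤`), contains `per_n`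
and (Leibniz) all `∂ per_n / ∂ x_ij`; a minimal prime over `I` then has height `≤ 4` by Krull's
height theorem and `≥ 5` by `vonzurGathen1987_singPerm_height_holds`.  (False for `n = 2`:
`per₂ = x₁₁ x₂₂ + x₂₁ x₁₂`.) [cite: Vonzurgathen1987, Lemma 2.3] -/
theorem perPoly_ne_sum_linear_mul {n : ℕ} (hn : 3 ≤ n) {κ : Type*} (s : Finset κ)
    (hs : s.card ≤ 2) (ℓ q : κ → MvPolynomial (Fin n × Fin n) ℂ)
    (hℓ : ∀ i ∈ s, (ℓ i).IsHomogeneous 1) :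
    perPoly (Fin n) ℂ ≠ ∑ i ∈ s, ℓ i * q i := by
  classical
  intro hper
  -- homogenise the cofactors to degree `n - 1`
  set q' : κ → MvPolynomial (Fin n × Fin n) ℂ := fun i => homogeneousComponent (n - 1) (q i)
    with hq'
  have hperhom : (perPoly (Fin n) ℂ).IsHomogeneous n := by
    simpa [Fintype.card_fin] using (perPoly_isHomogeneous (n := Fin n) (k := ℂ))
  have hper' : perPoly (Fin n) ℂ = ∑ i ∈ s, ℓ i * q' i := by
    have h := congr_arg (homogeneousComponent n) hper
    rw [homogeneousComponent_eq_self hperhom, map_sum] at h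
    rw [h]
    refine Finset.sum_congr rfl fun i hi => ?_
    have h1 := homogeneousComponent_mul_of_isHomogeneous (hℓ i hi) (q i) (n - 1)
    rw [show 1 + (n - 1) = n by omega] at h1
    exact h1
  -- the generators have no constant term
  have hℓ0 : ∀ i ∈ s, constantCoeff (ℓ i) = 0 := fun i hi =>
    (hℓ i hi).coeff_eq_zero (by simp)
  have hq0 : ∀ i, constantCoeff (q' i) = 0 := fun i =>
    (homogeneousComponent_isHomogeneous (n - 1) (q i)).coeff_eq_zero (by simp; omega)
  -- Kumar's ideal `I = (ℓ_i, q'_i)_i`, at most four generators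
  set S : Finset (MvPolynomial (Fin n × Fin n) ℂ) := s.image ℓ ∪ s.image q' with hS
  set I : Ideal (MvPolynomial (Fin n × Fin n) ℂ) := Ideal.span (S : Set _) with hI
  have hℓI : ∀ i ∈ s, ℓ i ∈ I := fun i hi => Ideal.subset_span (Finset.mem_coe.2
    (Finset.mem_union_left _ (Finset.mem_image_of_mem ℓ hi)))
  have hqI : ∀ i ∈ s, q' i ∈ I := fun i hi => Ideal.subset_span (Finset.mem_coe.2
    (Finset.mem_union_right _ (Finset.mem_image_of_mem q' hi)))
  have hS4 : S.card ≤ 4 :=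
    calc S.card ≤ (s.image ℓ).card + (s.image q').card := Finset.card_union_le _ _
      _ ≤ s.card + s.card := add_le_add Finset.card_image_le Finset.card_image_le
      _ ≤ 4 := by omega
  have hperI : perPoly (Fin n) ℂ ∈ I := by
    rw [hper']
    exact Ideal.sum_mem _ fun i hi => Ideal.mul_mem_left _ _ (hqI i hi)
  have hpd : ∀ x, pderiv x (perPoly (Fin n) ℂ) ∈ I := by
    intro x
    rw [hper', map_sum]
    refine Ideal.sum_mem _ fun i hi => ?_
    rw [Derivation.leibniz, smul_eq_mul, smul_eq_mul]
    exact Ideal.add_mem _ (Ideal.mul_mem_right _ _ (hℓI i hi)) (Ideal.mul_mem_right _ _ (hqI i hi))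
  have hsing : singPermIdeal ℂ n ≤ I := by
    rw [singPermIdeal, Ideal.span_le]
    rintro f hf
    rcases hf with rfl | ⟨ij, rfl⟩
    · exact hperI
    · exact hpd ij
  -- `I` is proper: it lies in the irrelevant ideal
  have hIker : I ≤ RingHom.ker (constantCoeff : MvPolynomial (Fin n × Fin n) ℂ →+* ℂ) := by
    rw [hI, Ideal.span_le]
    intro f hf
    rw [SetLike.mem_coe, RingHom.mem_ker]
    rw [Finset.mem_coe, hS, Finset.mem_union, Finset.mem_image, Finset.mem_image] at hf
    rcases hf with ⟨i, hi, rfl⟩ | ⟨i, -, rfl⟩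
    · exact hℓ0 i hi
    · exact hq0 i
  have hItop : I ≠ ⊤ := fun htop => RingHom.ker_ne_top _ (top_le_iff.1 (htop ▸ hIker))
  -- a minimal prime over `I`: height `≤ 4` (Krull) and `≥ 5` (von zur Gathen)
  obtain ⟨⟨Q, hQ⟩⟩ := Ideal.nonempty_minimalPrimes hItop
  have h4 : Q.height ≤ 4 :=
    (Ideal.height_le_card_of_mem_minimalPrimes_span_finset hQ).trans (by exact_mod_cast hS4)
  have h5 : (5 : ℕ∞) ≤ Q.height :=
    vonzurGathen1987_singPerm_height_holds ℂ two_ne_zero n hn Q hQ.1.1 (hsing.trans hQ.1.2)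
  exact absurd (h5.trans h4) (by decide)

/-! ### The theorem -/

/-- **Levelled representations have `adj L = 0`** (the mathematical content of
`UlrichPadded.LevelledCorankTwo`): for `n ≥ 3`, an affine determinantal representation `A` of
`per_n` with integer row/column weights `α, β` such that `α i + β j = 0` on the support of the
constant part and `α i + β j = 1` on the support of the linear part `L` has `adj L = 0`
(i.e. `corank_{ℂ(x)} L ≥ 2`).  Proof in the module docstring. [folklore] -/
theorem adjugate_linPart_eq_zero {n : ℕ} (hn : 3 ≤ n) {m : ℕ}
    (A : Matrix (Fin m) (Fin m) (MvPolynomial (Fin n × Fin n) ℂ))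
    (hA : IsAffineDetRepr (perPoly (Fin n) ℂ) A) (α β : Fin m → ℤ)
    (h0 : ∀ i j, constantCoeff (A i j) ≠ 0 → α i + β j = 0)
    (h1 : ∀ i j, homogeneousComponent 1 (A i j) ≠ 0 → α i + β j = 1) :
    (Matrix.of fun a b => homogeneousComponent 1 (A a b)).adjugate = 0 := by
  classical
  set L : Matrix (Fin m) (Fin m) (MvPolynomial (Fin n × Fin n) ℂ) :=
    Matrix.of fun a b => homogeneousComponent 1 (A a b) with hL
  have hLapply : ∀ i j, L i j = homogeneousComponent 1 (A i j) := fun _ _ => rfl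
  set A₀ : Matrix (Fin m) (Fin m) ℂ := A.map constantCoeff with hA₀
  have hA₀apply : ∀ i j, A₀ i j = constantCoeff (A i j) := fun _ _ => rfl
  have h0' : ∀ i j, A₀ i j ≠ 0 → α i + β j = 0 := fun i j h => h0 i j (by rwa [hA₀apply] at h)
  have h1' : ∀ i j, L i j ≠ 0 → α i + β j = 1 := fun i j h => h1 i j (by rwa [hLapply] at h)
  have hdecomp : ∀ i j, A i j = C (A₀ i j) + L i j := fun i j => by
    rw [hA₀apply, hLapply]
    exact eq_C_add_homogeneousComponent_one (hA.1 i j)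
  -- Step 2: `det A₀ = per_n(0) = 0`
  have hdet0 : A₀.det = 0 := by
    have h := RingHom.map_det (constantCoeff : MvPolynomial (Fin n × Fin n) ℂ →+* ℂ) A
    rw [RingHom.mapMatrix_apply] at h
    rw [hA₀, ← h, hA.2]
    exact constantCoeff_perPoly ℂ (by omega)
  -- Step 3: a left null vector, restricted to one row level `t`
  obtain ⟨w, hw0, hwA⟩ := Matrix.exists_vecMul_eq_zero_iff.2 hdet0
  obtain ⟨i₀, hi₀⟩ : ∃ i₀, w i₀ ≠ 0 := by
    by_contra h
    push Not at h
    exact hw0 (funext h)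
  set t : ℤ := α i₀ with ht
  set w' : Fin m → ℂ := fun i => if α i = t then w i else 0 with hw'
  have hw'i₀ : w' i₀ = w i₀ := by
    show (if α i₀ = t then w i₀ else 0) = w i₀
    rw [if_pos ht.symm]
  have hw'ne : w' i₀ ≠ 0 := by rwa [hw'i₀]
  have hw'supp : ∀ i, w' i ≠ 0 → α i = t := by
    intro i hi
    by_contra h
    exact hi (by show (if α i = t then w i else 0) = 0; rw [if_neg h])
  -- Step 4: `w' ᵥ* A₀ = 0` (block structure of `A₀`)
  have hw'A : ∀ j, ∑ i, w' i * A₀ i j = 0 := by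
    intro j
    by_cases hj : -β j = t
    · have hrow : ∀ i, w' i * A₀ i j = w i * A₀ i j := by
        intro i
        by_cases hi : α i = t
        · show (if α i = t then w i else 0) * A₀ i j = w i * A₀ i j
          rw [if_pos hi]
        · have hz : A₀ i j = 0 := by
            by_contra hne
            have := h0' i j hne
            exact hi (by omega)
          rw [hz, mul_zero, mul_zero]
      rw [Finset.sum_congr rfl fun i _ => hrow i]
      have := congr_fun hwA j
      simpa [Matrix.vecMul, dotProduct] using this
    · refine Finset.sum_eq_zero fun i _ => ?_
      by_cases hi : w' i = 0
      · rw [hi, zero_mul]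
      · have hαi := hw'supp i hi
        have hz : A₀ i j = 0 := by
          by_contra hne
          have := h0' i j hne
          exact hj (by omega)
        rw [hz, mul_zero]
  -- Step 5: the row `b = (C ∘ w') ᵥ* L = (C ∘ w') ᵥ* A` and Laplace through `A · adj A = per • 1`
  set b : Fin m → MvPolynomial (Fin n × Fin n) ℂ := fun j => ∑ i, C (w' i) * L i j with hb
  have hWA : (fun i => C (w' i)) ᵥ* A = b := by
    funext j
    show ∑ i, C (w' i) * A i j = ∑ i, C (w' i) * L i j
    calc ∑ i, C (w' i) * A i j = ∑ i, (C (w' i * A₀ i j) + C (w' i) * L i j) := by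
          refine Finset.sum_congr rfl fun i _ => ?_
          rw [hdecomp i j, mul_add, C_mul]
      _ = C (∑ i, w' i * A₀ i j) + ∑ i, C (w' i) * L i j := by
          rw [Finset.sum_add_distrib, map_sum]
      _ = ∑ i, C (w' i) * L i j := by rw [hw'A j, C_0, zero_add]
  have hkey : C (w' i₀) * perPoly (Fin n) ℂ = ∑ j, b j * A.adjugate j i₀ := by
    have h := Matrix.vecMul_vecMul (fun i => C (w' i)) A A.adjugate
    rw [Matrix.mul_adjugate, hA.2, Matrix.vecMul_smul, Matrix.vecMul_one, hWA] at h
    have h' := congr_fun h i₀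
    change ∑ j, b j * A.adjugate j i₀ = perPoly (Fin n) ℂ * C (w' i₀) at h'
    rw [h', mul_comm]
  -- Step 6: `b` is supported on the columns of level `t - 1`, and consists of linear forms
  have hbzero : ∀ j, -β j ≠ t - 1 → b j = 0 := by
    intro j hj
    refine Finset.sum_eq_zero fun i _ => ?_
    by_cases hi : w' i = 0
    · rw [hi, C_0, zero_mul]
    · have hαi := hw'supp i hi
      have hz : L i j = 0 := by
        by_contra hne
        have := h1' i j hne
        exact hj (by omega)
      rw [hz, mul_zero]
  have hbhom : ∀ j, (b j).IsHomogeneous 1 := by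
    intro j
    refine IsHomogeneous.sum Finset.univ (fun i => C (w' i) * L i j) 1 fun i _ => ?_
    have := (isHomogeneous_C (Fin n × Fin n) (w' i)).mul
      (homogeneousComponent_isHomogeneous 1 (A i j))
    simpa [hLapply] using this
  -- Step 7: level `t - 1` has at least three columns (von zur Gathen, Lemma 2.3)
  set J : Finset (Fin m) := Finset.univ.filter fun j => -β j = t - 1 with hJ
  have hJ3 : 3 ≤ J.card := by
    by_contra hlt
    push Not at hlt
    have hsum : perPoly (Fin n) ℂ = ∑ j ∈ J, b j * (C ((w i₀)⁻¹) * A.adjugate j i₀) := by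
      have hu : C ((w i₀)⁻¹) * C (w' i₀) = (1 : MvPolynomial (Fin n × Fin n) ℂ) := by
        rw [hw'i₀, ← C_mul, inv_mul_cancel₀ hi₀, C_1]
      calc perPoly (Fin n) ℂ = C ((w i₀)⁻¹) * (C (w' i₀) * perPoly (Fin n) ℂ) := by
            rw [← mul_assoc, hu, one_mul]
        _ = C ((w i₀)⁻¹) * ∑ j, b j * A.adjugate j i₀ := by rw [hkey]
        _ = ∑ j, b j * (C ((w i₀)⁻¹) * A.adjugate j i₀) := by
            rw [Finset.mul_sum]
            exact Finset.sum_congr rfl fun j _ => by ring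
        _ = ∑ j ∈ J, b j * (C ((w i₀)⁻¹) * A.adjugate j i₀) := by
            symm
            apply Finset.sum_subset (Finset.subset_univ J)
            intro j _ hj
            rw [hbzero j (by simpa [hJ] using hj), zero_mul]
    exact perPoly_ne_sum_linear_mul hn J (by omega) b _ (fun j _ => hbhom j) hsum
  -- Step 8: `#{rows of level ≥ t} ≤ #{columns of level ≥ t} + 1` (von zur Gathen, Thm. 3.1)
  set Rset : Finset (Fin m) := Finset.univ.filter fun i => t ≤ α i with hR
  set C' : Finset (Fin m) := Finset.univ.filter fun j => t ≤ -β j with hC'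
  have hF1 : Rset.card ≤ C'.card + 1 := by
    by_contra hlt
    push Not at hlt
    -- all submaximal minors of `A₀` vanish
    have hadj : A₀.adjugate = 0 := by
      refine Matrix.ext fun p q => ?_
      rw [Matrix.adjugate_apply, Matrix.zero_apply]
      apply det_eq_zero_of_rows_supported _ (Rset.erase q) C'
      · intro i hi j hj
        have hiq : i ≠ q := Finset.ne_of_mem_erase hi
        have hiR : i ∈ Rset := Finset.mem_of_mem_erase hi
        rw [Matrix.updateRow_ne hiq]
        by_contra hne
        have h := h0' i j hne
        simp only [hR, Finset.mem_filter, Finset.mem_univ, true_and] at hiR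
        simp only [hC', Finset.mem_filter, Finset.mem_univ, true_and] at hj
        omega
      · have := Finset.pred_card_le_card_erase (s := Rset) (a := q)
        omega
    refine false_of_adjugate_eval_eq_zero vonzurGathen1987_submaximalMinors_height_holds
      vonzurGathen1987_singPerm_height_holds (K := ℂ) two_ne_zero hn hA.2
      (w := (0 : Fin n × Fin n → ℂ)) ?_
    rw [MvPolynomial.eval_zero]
    have hmap := RingHom.map_adjugate (constantCoeff : MvPolynomial (Fin n × Fin n) ℂ →+* ℂ) A
    rw [RingHom.mapMatrix_apply, RingHom.mapMatrix_apply] at hmap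
    rw [hmap]
    exact hadj
  -- Step 9: the columns of level `≥ t - 1` of `L` are supported in the rows of level `≥ t`
  set Cset : Finset (Fin m) := Finset.univ.filter fun j => t - 1 ≤ -β j with hC
  have hCJ : Cset = J ∪ C' := by
    ext j
    simp only [hC, hJ, hC', Finset.mem_filter, Finset.mem_univ, true_and, Finset.mem_union]
    omega
  have hdisj : Disjoint J C' := by
    rw [Finset.disjoint_left]
    intro j hj hj'
    simp only [hJ, Finset.mem_filter, Finset.mem_univ, true_and] at hj
    simp only [hC', Finset.mem_filter, Finset.mem_univ, true_and] at hj'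
    omega
  have hCcard : Rset.card + 2 ≤ Cset.card := by
    rw [hCJ, Finset.card_union_of_disjoint hdisj]
    omega
  refine Matrix.ext fun p q => ?_
  rw [Matrix.adjugate_apply, Matrix.zero_apply]
  apply det_eq_zero_of_cols_supported _ Cset (insert q Rset)
  · intro j hj i hi
    rw [Finset.mem_insert, not_or] at hi
    rw [Matrix.updateRow_ne hi.1]
    by_contra hne
    have h := h1' i j hne
    simp only [hC, Finset.mem_filter, Finset.mem_univ, true_and] at hj
    have hiR := hi.2
    simp only [hR, Finset.mem_filter, Finset.mem_univ, true_and] at hiR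
    omega
  · calc (insert q Rset).card ≤ Rset.card + 1 := Finset.card_insert_le _ _
      _ < Cset.card := by omega

end LevelledCorankTwo

/-- **Support item `UlrichPadded.LevelledCorankTwo` (stmt-ValiantsHypothesis-15033), proved:** for
`n ≥ 3`, if an affine determinantal representation `A = A₀ + L` of `per_n` admits integer
row/column weights `α, β` with `α i + β j = 0` on the support of `A₀` and `α i + β j = 1` on the
support of `L` (levelled / torus-graded representations: layered ABPs, formulas, Grenet's
matrices), then `adj L = 0` identically — `corank_{ℂ(x)} L ≥ 2`, so such representations are never
tight at infinity. [folklore] -/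
theorem levelledCorankTwo_proof :
    Summit.ValiantsHypothesis.ValiantsHypothesis.Theses.UlrichPadded.LevelledCorankTwo := by
  unfold Summit.ValiantsHypothesis.ValiantsHypothesis.Theses.UlrichPadded.LevelledCorankTwo
  intro n hn m A hA α β h0 h1
  exact LevelledCorankTwo.adjugate_linPart_eq_zero hn A hA α β h0 h1

end Summit.ValiantsHypothesis.Theorems

end
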